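import Summits.BirchSwinnertonDyer.Rank1Residual.X2.CongruenceTransferCoveredNonsplit
import Summits.BirchSwinnertonDyer.Rank1Residual.Partition.MazurMainConjectureAtThreeOPEN
import HarnessLib

/-!
# Class X2, route G with a COVERED partner AT THE PRIME 3: the non-split heads RE-ROUTED from the published binder
# `CastellaGrossiSkinner2025.thmA_charIdeal_eq_padicLFunction` to the typed `p = 3` tier
# `RowC6.CastellaGrossiSkinner2025_thmA_atThree_OPEN` (cell `bsd-litref`, sub-dir `bstw24`, seat `bsd-litref-bstw24-pv`
# = the T2b prover: «re-route the T-EISRG3C consumers to the refereed statement once it exists»; companion of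
# `X2/CongruenceTransferCoveredNonsplit.lean` (b2b-bsdres eisenstein-p2 gen 14) and of
# `Partition/MazurMainConjectureAtThreeOPEN.lean` (bsd-litref-cgs25-ty, p461118))

HONEST FRAMING (programme BSD-LIT2PART v1 §T2 / §HONESTY; cell README): nothing here proves BSD for any curve and
no cell of the register moves by this file. WHY THIS FILE: every one of the T-EISRG3C (class, 3) cells of row A10
(corner X2: `E[3]` reducible, NON-split multiplicative at `3`, `r = 0`, ¬GVPar; 31 keys at referee A R299.6, 22 after
the fold of referee B R314, 29 when OFFER-EIS-A10HESSE-B10 books — lists in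
`pub/bsd-litref/bstw24/staging/bsd-litref-bstw24-pv/CONSUMERS.md` §1 / PRICING draft §iii-0) closes through the two heads
`X2.mazurMainConjectureAt_of_coveredRelative_of_not_split` / `X2.bsdp_of_coveredRelative_rankZero_of_not_split`, which
take `hA : thmA_charIdeal_eq_padicLFunction` (CGS25 Thm A, Math. Ann. 393 (2025), PUBLISHED) and use it at ONE term,
`X2.mazurMainConjecture_of_thmA W′ 3 hA …`, for the good-ordinary `3`-reducible non-anomalous relative `W′`. The
in-cell referees of Thm A's Beilinson–Flach node (printed Thm 4.1.1 «proved in [BSTW23, §5]» = arXiv:2409.01350v2 §5)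
ruled, independently and concurring (D-AUDIT-bstw24-r1 2ab68891cb7b08bc O3/O4; D-AUDIT-bstw24-r2 69e4de3690fd21dc
N1/N1′): **PASS-in-cell at `p ≥ 5`; GAP(line) at `p = 3`** — BSTW TeX l.2915 (note after Thm 4.1) and l.4918–4922
(Rem 6.1): [KLZ17] §§7–10 are printed for `p ≥ 5` and BSTW's own bridge to `3` is «likely» + [Ca] (partial: Cais 2018
treats the closed curve / non-trivial tame eigenspace) + [SV-S-Ohta] (Sangiovanni Vincentelli–Skinner, UNPUBLISHED,
publicly unlocated 2026-08-26); residual named R3-ord (h-side (3-ii)♭′ + B1; g-side G3g). The gap is TYPED as ONE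
claim-tagged binder at the cells' own prime, `RowC6.CastellaGrossiSkinner2025_thmA_atThree_OPEN` (= Thm A's tree
statement VERBATIM with `2 < p` replaced by `p = 3`; p461118), implied by `hA` (`RowC6.thmA_atThree_OPEN_of_thmA`).
This file is the A10 side of that tier split: the SAME three non-split heads with `hA` replaced by the `p = 3` binder
`hA3`, so that a T-EISRG3C display re-routed through them reads, in the kernel, modulo {PUBLISHED named facts} + ONE
named PRE binder carrying exactly the located gap + its per-pair instrument certificates — the register's component
string attached to a DECL (director ruling (i), referee C R263: per-class component), never stronger than the
published road (`…_of_thmA` sandwiches below). Nothing asserted; no new binder; theorems only.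

RE-DISPLAY RECIPE (per cell `<T>`, part 2 only; part 1 `X2/RouteGSplitDisplay<T>Local.lean` is REUSED unchanged): copy
`X2/RouteGSplitDisplay<T>.lean` into namespace `…RouteGSplitDisplay<T>AtThree`, add this import, replace the binder
`(hA : thmA_charIdeal_eq_padicLFunction)` by `(hA3 : RowC6.CastellaGrossiSkinner2025_thmA_atThree_OPEN)`, the two
`exact` heads by the `…AtThree…` heads below with `hp3 := rfl` in place of `hp2`, and reuse `good_outside_S₀` /
`sum_delta` QUALIFIED from the landed part 2 (only the private `S₀` membership lemmas are re-proved). Filed by this seat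
for the cells the eis planner / referee B ask for (booking currency is theirs); none is filed by this file.

## Contents
* `X2.mazurMainConjecture_of_thmA_atThree_OPEN` — the `p = 3` binder supplies `MazurMainConjecture W′ p` at `p = 3`
  for a good, `p`-reducible, non-anomalous `W′` (twin of `X2.mazurMainConjecture_of_thmA`).
* `X2.algebraicInvariantsEq_of_coveredRelativeAtThree_of_facts` — §2 transfer head at `p = 3`, shift DERIVED.
* `X2.mazurMainConjectureAt_of_coveredRelativeAtThree_of_not_split`, `X2.bsdp_of_coveredRelativeAtThree_rankZero_of_not_split`,
  `X2.missingInputB_of_coveredRelativeAtThree_of_not_split` — the three non-split heads at `p = 3` on `hA3`.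
* Sandwich: `X2.mazurMainConjectureAt_of_coveredRelativeAtThree_of_not_split_of_thmA` — fed by `hA` through
  `RowC6.thmA_atThree_OPEN_of_thmA` the re-routed head gives back the published-road conclusion (so a re-display is never
  a stronger claim than the booked display).

References: [CastellaGrossiSkinner2025] Thm A (= Thm 7.1.1), Thm 4.1.1 (TeX l.1683–1704); [BurungaleSkinnerTianWan2024]
§5, TeX l.2915, l.4918–4922 (PRE); [GreenbergVatsal2000] Thm (1.4), §1 (5)–(7), §2; [Wuthrich2014] Thm 16; [SteinWuthrich2013]
Thm 6.1; referee rounds B R252.4 / C R263 / C R278 / A R299.5 / B R314; sheets D-AUDIT-bstw24-r1 (2ab68891cb7b08bc)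
+ ADDENDUM-1 (dd57a5d99fb5bd7f), D-AUDIT-bstw24-r2 (69e4de3690fd21dc) + ADDENDUM-1 (850c38dd32e26b8a).
-/

set_option autoImplicit false

noncomputable section

open scoped Classical MatrixGroups ModularForm

open PowerSeries CongruenceSubgroup WeierstrassCurve NumberField IsDedekindDomain
  Literature.NumberTheory.EllipticCurves
  Literature.NumberTheory.EllipticCurves.ModularForms
  Literature.NumberTheory.EllipticCurves.Rank1Residual
  Literature.NumberTheory.EllipticCurves.Rank1Residual.Typed
  Literature.NumberTheory.EllipticCurves.Wuthrich2014
  Literature.NumberTheory.EllipticCurves.SteinWuthrich2013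
  Literature.NumberTheory.EllipticCurves.Greenberg1999
  Literature.NumberTheory.EllipticCurves.GreenbergVatsal2000
  Literature.NumberTheory.EllipticCurves.CastellaGrossiSkinner2025
  Summit.BirchSwinnertonDyer.BirchSwinnertonDyer.Theorems.Rank1ResidualX1Defs
  Summit.BirchSwinnertonDyer.Rank1Residual.X1.MuLambda
  Summit.BirchSwinnertonDyer.Rank1Residual.X1.MuPart
  Summit.BirchSwinnertonDyer.Rank1Residual.X1.ParitySqueeze
  Summit.BirchSwinnertonDyer.Rank1Residual.X1.TamagawaSqueeze
  Summit.BirchSwinnertonDyer.Rank1Residual.X1.CongruenceTransfer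
  Summit.BirchSwinnertonDyer.Rank1Residual.X2.CongruentLambdaShiftMultiplicative

namespace Summit.BirchSwinnertonDyer.Rank1Residual.X2

/-! ## §1 The `p = 3` tier binder supplies the relative's main conjecture -/

section Covered

variable (W' : WeierstrassCurve ℚ) [W'.IsElliptic] [W'.IsGloballyMinimal] (p : ℕ) [Fact p.Prime]

/-- **The typed `p = 3` tier of Castella–Grossi–Skinner 2025 Thm A supplies the tree's `MazurMainConjecture W′ p` at
`p = 3`** for a globally minimal `E₀′/ℚ` with GOOD reduction at `3`, `E₀′[3]` REDUCIBLE and `a₃(E₀′) ≢ 1 (mod 3)` — the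
exact twin of `X2.mazurMainConjecture_of_thmA` with the PUBLISHED binder replaced by the claim-tagged `p = 3` binder
`RowC6.CastellaGrossiSkinner2025_thmA_atThree_OPEN` (p461118), which carries the in-cell referees' located GAP(line)
(BSTW TeX l.2915 / l.4918–4922 ⇐ [SV-S-Ohta] PRE). CONDITIONAL on that binder; closes nothing.
[claim: BurungaleSkinnerTianWan2024, status: under-review] [cite: CastellaGrossiSkinner2025, Theorem A (§1) = Thm. 7.1.1] -/
theorem mazurMainConjecture_of_thmA_atThree_OPEN (hA3 : RowC6.CastellaGrossiSkinner2025_thmA_atThree_OPEN)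
    (hp3 : p = 3) (hgood' : W'.HasGoodReductionAtPrime p) (hred' : ¬ W'.HasIrreducibleModPGaloisRep p)
    (hna' : ¬ (p : ℤ) ∣ W'.frobeniusTrace p - 1) : MazurMainConjecture W' p :=
  fun κ γ hκ hγ hT ↦ hA3 W' p hp3 hgood' hred' (fun h ↦ hna' h.2.2) κ γ hκ hγ hT

end Covered

/-! ## §2 X2 target with a covered relative at `p = 3`: the transferred invariants (shift DERIVED) -/

section Relative

variable {W W' : WeierstrassCurve ℚ} [W.IsElliptic] [W.IsGloballyMinimal]
  [W'.IsElliptic] [W'.IsGloballyMinimal] {p : ℕ} [Fact p.Prime]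
  (S₀ : Finset (HeightOneSpectrum (𝓞 ℚ)))

/-- **X2 target at `p = 3`, COVERED relative ⇒ `(μ_alg, λ_alg)(E₀) = (0, k)`, shift DERIVED** —
`X2.algebraicInvariantsEq_of_coveredRelative_of_facts` VERBATIM with the relative's main conjecture supplied by the
`p = 3` tier binder (`mazurMainConjecture_of_thmA_atThree_OPEN`) instead of the published `hA`; ordinarity of the
relative by Serre (`not_dvd_frobeniusTrace_of_red_of_good`), the shift by `congruentLambdaShift_mult_goodOrd_of_facts`
(Tate A40/A41 `hT hT'`, GV (5)–(7) at `p ‖ N` `hAm`, GV Prop 2.5 `hBm`, GV p. 15 `hF`, GV p. 26 `hGV`, GV (7) `hA7`,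
GV p. 8 `hB`). CONDITIONAL on `hA3`; closes nothing. [claim: BurungaleSkinnerTianWan2024, status: under-review]
[cite: GreenbergVatsal2000, Thm. (1.4), §1 (5)–(7), pp. 14–15, §2 pp. 20–27] [cite: Wuthrich2014, Thm. 16 (p. 397)] -/
theorem algebraicInvariantsEq_of_coveredRelativeAtThree_of_facts
    (hA3 : RowC6.CastellaGrossiSkinner2025_thmA_atThree_OPEN)
    (hWu : thm16_charIdeal_dvd_multiplicative_of_reducible)
    (hW16 : Wuthrich2014.charIdeal_dvd_padicLFunction)
    (hpar : nonempty_modularParametrizationData)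
    (hT : Silverman1994_thmV53_corV54_tateUniformisation.{0})
    (hT' : Silverman1994_thmV53_tateUniformisation.{0})
    (hAm : lambda_nonPrimitive_eq_add_sum_delta_multiplicative)
    (hBm : datumSelmer_divisible_of_finite_torsionBy) (hF : datumStrictSelmer_lt_datumSelmer_of_split)
    (hGV : imKummer_ge_greenbergCondition_at_p) (hA7 : lambda_nonPrimitive_eq_add_sum_delta)
    (hB : divisible_nonPrimitiveSelmerInfty_of_mu_eq_zero) (hp3 : p = 3)
    (hmult : W.HasMultiplicativeReductionAtPrime p) (hred : ¬ W.HasIrreducibleModPGaloisRep p)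
    (hμ0 : AnalyticMuLE W p 0)
    (hgood' : W'.HasGoodReductionAtPrime p) (hred' : ¬ W'.HasIrreducibleModPGaloisRep p)
    (hna' : ¬ (p : ℤ) ∣ W'.frobeniusTrace p - 1) {n' : ℕ}
    (hμ0' : X1.MuPart.AnalyticMuLE W' p 0) (hlam' : X1.ParitySqueeze.AnalyticLambdaEq W' p n')
    (hS₀ : ∀ v ∈ S₀, ((p : ℕ) : 𝓞 ℚ) ∉ v.asIdeal)
    (hS : ∀ v : HeightOneSpectrum (𝓞 ℚ), v ∉ S₀ → ((p : ℕ) : 𝓞 ℚ) ∉ v.asIdeal →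
      W.HasGoodReductionAt v)
    (hS' : ∀ v : HeightOneSpectrum (𝓞 ℚ), v ∉ S₀ → ((p : ℕ) : 𝓞 ℚ) ∉ v.asIdeal →
      W'.HasGoodReductionAt v)
    (hiso : TorsionIso W W' p) {k : ℕ}
    (hk : (k : ℤ) = n' + (∑ v ∈ S₀, ((delta W' p v : ℤ) - (delta W p v : ℤ)) -
      (if W.HasSplitMultiplicativeReductionAtPrime p then 1 else 0))) :
    AlgebraicInvariantsEq W p k :=
  have hp2 : p ≠ 2 := by omega
  have hp : 2 < p := by omega
  algebraicInvariantsEq_of_closedRelative_goodOrd hWu hW16 hpar hp2 hmult hred hμ0 hgood'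
    (not_dvd_frobeniusTrace_of_red_of_good W' p hp hgood' hred') hred'
    (mazurMainConjecture_of_thmA_atThree_OPEN W' p hA3 hp3 hgood' hred' hna') hμ0' hlam' hiso
    (CongruentLambdaShiftMultiplicative.congruentLambdaShift_mult_goodOrd_of_facts W W' S₀ hT hT' hAm
      hBm hF hGV hA7 hB hp2 hmult hgood' (not_dvd_frobeniusTrace_of_red_of_good W' p hp hgood' hred')
      hS₀ hS hS')
    hk

end Relative

/-! ## §3 The three NON-SPLIT heads at `p = 3` on the tier binder -/

section NonSplit

variable {W W' : WeierstrassCurve ℚ} [W.IsElliptic] [W.IsGloballyMinimal]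
  [W'.IsElliptic] [W'.IsGloballyMinimal] {p : ℕ} [Fact p.Prime]
  (S₀ : Finset (HeightOneSpectrum (𝓞 ℚ)))

/-- **NON-SPLIT X2 pair at `p = 3`, COVERED relative, shift DERIVED ⇒ Mazur's main conjecture at the pair** —
`X2.mazurMainConjectureAt_of_coveredRelative_of_not_split` VERBATIM (same binders, same order, same certificate shape)
with `hA` replaced by the `p = 3` tier binder `hA3` and `hp2 : p ≠ 2` by `hp3 : p = 3`. The head a re-routed
T-EISRG3C display calls for `X2.MazurMainConjectureAt W 3`. CONDITIONAL on `hA3` + the per-pair certificates; closes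
nothing; nothing booked. [claim: BurungaleSkinnerTianWan2024, status: under-review]
[cite: GreenbergVatsal2000, Thm. (1.4), §1 (5)–(7), pp. 14–15, §2 pp. 20–27] [cite: Wuthrich2014, Thm. 16 (p. 397)] -/
theorem mazurMainConjectureAt_of_coveredRelativeAtThree_of_not_split
    (hA3 : RowC6.CastellaGrossiSkinner2025_thmA_atThree_OPEN)
    (hWu : thm16_charIdeal_dvd_multiplicative_of_reducible)
    (hW16 : Wuthrich2014.charIdeal_dvd_padicLFunction)
    (hpar : nonempty_modularParametrizationData)
    (hT : Silverman1994_thmV53_corV54_tateUniformisation.{0})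
    (hT' : Silverman1994_thmV53_tateUniformisation.{0})
    (hAm : lambda_nonPrimitive_eq_add_sum_delta_multiplicative)
    (hBm : datumSelmer_divisible_of_finite_torsionBy) (hF : datumStrictSelmer_lt_datumSelmer_of_split)
    (hGV : imKummer_ge_greenbergCondition_at_p) (hA7 : lambda_nonPrimitive_eq_add_sum_delta)
    (hB : divisible_nonPrimitiveSelmerInfty_of_mu_eq_zero) (hp3 : p = 3)
    (hmult : W.HasMultiplicativeReductionAtPrime p)
    (hns : ¬ W.HasSplitMultiplicativeReductionAtPrime p) (hred : ¬ W.HasIrreducibleModPGaloisRep p)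
    {n : ℕ} (hμ0 : AnalyticMuLE W p 0) (hlam : AnalyticLambdaEq W p n)
    (hgood' : W'.HasGoodReductionAtPrime p)
    (hna' : ¬ (p : ℤ) ∣ W'.frobeniusTrace p - 1) {n' : ℕ}
    (hμ0' : X1.MuPart.AnalyticMuLE W' p 0) (hlam' : X1.ParitySqueeze.AnalyticLambdaEq W' p n')
    (hS₀ : ∀ v ∈ S₀, ((p : ℕ) : 𝓞 ℚ) ∉ v.asIdeal)
    (hS : ∀ v : HeightOneSpectrum (𝓞 ℚ), v ∉ S₀ → ((p : ℕ) : 𝓞 ℚ) ∉ v.asIdeal →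
      W.HasGoodReductionAt v)
    (hS' : ∀ v : HeightOneSpectrum (𝓞 ℚ), v ∉ S₀ → ((p : ℕ) : 𝓞 ℚ) ∉ v.asIdeal →
      W'.HasGoodReductionAt v)
    (hiso : TorsionIso W W' p) {k : ℕ}
    (hk : (k : ℤ) = n' + ∑ v ∈ S₀, ((delta W' p v : ℤ) - (delta W p v : ℤ))) (hn : n ≤ k) :
    X2.MazurMainConjectureAt W p :=
  have hp2 : p ≠ 2 := by omega
  mazurMainConjectureAt_of_algebraicInvariantsEq hWu W p hp2 hmult hred hμ0 hlam
    (algebraicInvariantsEq_of_coveredRelativeAtThree_of_facts S₀ hA3 hWu hW16 hpar hT hT' hAm hBm hF hGV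
      hA7 hB hp3 hmult hred hμ0 hgood' (not_hasIrreducibleModPGaloisRep_of_torsionIso hiso hred) hna'
      hμ0' hlam' hS₀ hS hS' hiso (by rw [if_neg hns, sub_zero]; exact hk))
    (fun _ ↦ hn) (fun h ↦ absurd h hns)

/-- **NON-SPLIT X2b pair (rank `0`) at `p = 3`, COVERED relative, shift DERIVED ⇒ `BSD(E₀, 3)`** —
`X2.bsdp_of_coveredRelative_rankZero_of_not_split` VERBATIM with `hA ↦ hA3`, `hp2 ↦ hp3`; last step gen 1's
`bsdp_of_mazurMainConjectureAt_of_analyticRank_eq_zero` (Stein–Wuthrich Thm 6.1, Greenberg–Stevens, GZK, modularity).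
The head a re-routed T-EISRG3C display calls for `BSDp W 3`. CONDITIONAL on `hA3` + certificates; closes nothing;
nothing booked. [claim: BurungaleSkinnerTianWan2024, status: under-review]
[cite: GreenbergVatsal2000, Thm. (1.4), §1 (5)–(7), pp. 14–15, §2 pp. 20–27] [cite: Wuthrich2014, Thm. 16 (p. 397)]
[cite: SteinWuthrich2013, Thm. 6.1 (p. 20)] [cite: Miller2011LMS, Def. 1.1] -/
theorem bsdp_of_coveredRelativeAtThree_rankZero_of_not_split
    (hA3 : RowC6.CastellaGrossiSkinner2025_thmA_atThree_OPEN)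
    (hWu : thm16_charIdeal_dvd_multiplicative_of_reducible)
    (hW16 : Wuthrich2014.charIdeal_dvd_padicLFunction)
    (hJs : thm61_splitMultiplicative) (hJn : thm61_nonsplitMultiplicative)
    (hHs : exists_isSplitMultCanonical) (hHn : exists_isMultCanonical)
    (hGZK : rank_eq_analyticRank_of_analyticRank_le_one) (hmod : hasEntireLFunction_rat)
    (hpar : nonempty_modularParametrizationData)
    (hT : Silverman1994_thmV53_corV54_tateUniformisation.{0})
    (hT' : Silverman1994_thmV53_tateUniformisation.{0})
    (hAm : lambda_nonPrimitive_eq_add_sum_delta_multiplicative)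
    (hBm : datumSelmer_divisible_of_finite_torsionBy) (hF : datumStrictSelmer_lt_datumSelmer_of_split)
    (hGV : imKummer_ge_greenbergCondition_at_p) (hA7 : lambda_nonPrimitive_eq_add_sum_delta)
    (hB : divisible_nonPrimitiveSelmerInfty_of_mu_eq_zero)
    (W W' : WeierstrassCurve ℚ) [W.IsElliptic] [W.IsGloballyMinimal] [W'.IsElliptic]
    [W'.IsGloballyMinimal] (p : ℕ) [Fact p.Prime] (hGS : greenberg_stevens (W := W) (p := p))
    (hp3 : p = 3) (hmult : W.HasMultiplicativeReductionAtPrime p)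
    (hns : ¬ W.HasSplitMultiplicativeReductionAtPrime p)
    (hred : ¬ W.HasIrreducibleModPGaloisRep p) (hr : W.analyticRank = 0) {n : ℕ}
    (hμ0 : AnalyticMuLE W p 0) (hlam : AnalyticLambdaEq W p n)
    (hgood' : W'.HasGoodReductionAtPrime p)
    (hna' : ¬ (p : ℤ) ∣ W'.frobeniusTrace p - 1) {n' : ℕ}
    (hμ0' : X1.MuPart.AnalyticMuLE W' p 0) (hlam' : X1.ParitySqueeze.AnalyticLambdaEq W' p n')
    (hS₀ : ∀ v ∈ S₀, ((p : ℕ) : 𝓞 ℚ) ∉ v.asIdeal)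
    (hS : ∀ v : HeightOneSpectrum (𝓞 ℚ), v ∉ S₀ → ((p : ℕ) : 𝓞 ℚ) ∉ v.asIdeal →
      W.HasGoodReductionAt v)
    (hS' : ∀ v : HeightOneSpectrum (𝓞 ℚ), v ∉ S₀ → ((p : ℕ) : 𝓞 ℚ) ∉ v.asIdeal →
      W'.HasGoodReductionAt v)
    (hiso : TorsionIso W W' p) {k : ℕ}
    (hk : (k : ℤ) = n' + ∑ v ∈ S₀, ((delta W' p v : ℤ) - (delta W p v : ℤ))) (hn : n ≤ k) :
    BSDp W p :=
  have hp2 : p ≠ 2 := by omega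
  bsdp_of_mazurMainConjectureAt_of_analyticRank_eq_zero hJs hJn hHs hHn hGZK hmod hpar W p hGS hp2
    hmult hr (mazurMainConjectureAt_of_coveredRelativeAtThree_of_not_split S₀ hA3 hWu hW16 hpar hT hT' hAm
      hBm hF hGV hA7 hB hp3 hmult hns hred hμ0 hlam hgood' hna' hμ0' hlam' hS₀ hS hS' hiso hk hn)

/-- **NON-SPLIT X2b pair at `p = 3`: its TYPED INPUT `MissingInputB W p` from a COVERED relative on the `p = 3` tier
binder** (bookkeeping form for the Partition; `MissingInputB = X2.MazurMainConjectureAt`) —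
`X2.missingInputB_of_coveredRelative_of_not_split` with `hA ↦ hA3`. CONDITIONAL; closes nothing.
[claim: BurungaleSkinnerTianWan2024, status: under-review] [cite: GreenbergVatsal2000, Thm. (1.4), §2 pp. 26–27]
[cite: Wuthrich2014, Thm. 16 (p. 397)] -/
theorem missingInputB_of_coveredRelativeAtThree_of_not_split
    (hA3 : RowC6.CastellaGrossiSkinner2025_thmA_atThree_OPEN)
    (hWu : thm16_charIdeal_dvd_multiplicative_of_reducible)
    (hW16 : Wuthrich2014.charIdeal_dvd_padicLFunction)
    (hpar : nonempty_modularParametrizationData)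
    (hT : Silverman1994_thmV53_corV54_tateUniformisation.{0})
    (hT' : Silverman1994_thmV53_tateUniformisation.{0})
    (hAm : lambda_nonPrimitive_eq_add_sum_delta_multiplicative)
    (hBm : datumSelmer_divisible_of_finite_torsionBy) (hF : datumStrictSelmer_lt_datumSelmer_of_split)
    (hGV : imKummer_ge_greenbergCondition_at_p) (hA7 : lambda_nonPrimitive_eq_add_sum_delta)
    (hB : divisible_nonPrimitiveSelmerInfty_of_mu_eq_zero)
    (W W' : WeierstrassCurve ℚ) [W.IsElliptic] [W.IsGloballyMinimal] [W'.IsElliptic]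
    [W'.IsGloballyMinimal] (p : ℕ) [Fact p.Prime] (hc : CellB W p) (hp3 : p = 3)
    (hns : ¬ W.HasSplitMultiplicativeReductionAtPrime p) {n : ℕ}
    (hμ0 : AnalyticMuLE W p 0) (hlam : AnalyticLambdaEq W p n)
    (hgood' : W'.HasGoodReductionAtPrime p)
    (hna' : ¬ (p : ℤ) ∣ W'.frobeniusTrace p - 1) {n' : ℕ}
    (hμ0' : X1.MuPart.AnalyticMuLE W' p 0) (hlam' : X1.ParitySqueeze.AnalyticLambdaEq W' p n')
    (hS₀ : ∀ v ∈ S₀, ((p : ℕ) : 𝓞 ℚ) ∉ v.asIdeal)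
    (hS : ∀ v : HeightOneSpectrum (𝓞 ℚ), v ∉ S₀ → ((p : ℕ) : 𝓞 ℚ) ∉ v.asIdeal →
      W.HasGoodReductionAt v)
    (hS' : ∀ v : HeightOneSpectrum (𝓞 ℚ), v ∉ S₀ → ((p : ℕ) : 𝓞 ℚ) ∉ v.asIdeal →
      W'.HasGoodReductionAt v)
    (hiso : TorsionIso W W' p) {k : ℕ}
    (hk : (k : ℤ) = n' + ∑ v ∈ S₀, ((delta W' p v : ℤ) - (delta W p v : ℤ))) (hn : n ≤ k) :
    MissingInputB W p :=
  mazurMainConjectureAt_of_coveredRelativeAtThree_of_not_split S₀ hA3 hWu hW16 hpar hT hT' hAm hBm hF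
    hGV hA7 hB hp3 hc.2.1.2.2 hns hc.2.1.2.1 hμ0 hlam hgood' hna' hμ0' hlam' hS₀ hS hS' hiso hk hn

/-- **Sandwich: the re-routed head is never stronger than the published road.** Fed by the PUBLISHED `hA` through
`RowC6.thmA_atThree_OPEN_of_thmA` (p461118), the `p = 3` head returns exactly the conclusion of the booked displays'
head `X2.mazurMainConjectureAt_of_coveredRelative_of_not_split` at `p = 3`. Composition only; closes nothing.
[cite: CastellaGrossiSkinner2025, Theorem A (§1) = Thm. 7.1.1] [cite: GreenbergVatsal2000, Thm. (1.4), §2 pp. 26–27] -/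
theorem mazurMainConjectureAt_of_coveredRelativeAtThree_of_not_split_of_thmA
    (hA : thmA_charIdeal_eq_padicLFunction)
    (hWu : thm16_charIdeal_dvd_multiplicative_of_reducible)
    (hW16 : Wuthrich2014.charIdeal_dvd_padicLFunction)
    (hpar : nonempty_modularParametrizationData)
    (hT : Silverman1994_thmV53_corV54_tateUniformisation.{0})
    (hT' : Silverman1994_thmV53_tateUniformisation.{0})
    (hAm : lambda_nonPrimitive_eq_add_sum_delta_multiplicative)
    (hBm : datumSelmer_divisible_of_finite_torsionBy) (hF : datumStrictSelmer_lt_datumSelmer_of_split)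
    (hGV : imKummer_ge_greenbergCondition_at_p) (hA7 : lambda_nonPrimitive_eq_add_sum_delta)
    (hB : divisible_nonPrimitiveSelmerInfty_of_mu_eq_zero) (hp3 : p = 3)
    (hmult : W.HasMultiplicativeReductionAtPrime p)
    (hns : ¬ W.HasSplitMultiplicativeReductionAtPrime p) (hred : ¬ W.HasIrreducibleModPGaloisRep p)
    {n : ℕ} (hμ0 : AnalyticMuLE W p 0) (hlam : AnalyticLambdaEq W p n)
    (hgood' : W'.HasGoodReductionAtPrime p)
    (hna' : ¬ (p : ℤ) ∣ W'.frobeniusTrace p - 1) {n' : ℕ}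
    (hμ0' : X1.MuPart.AnalyticMuLE W' p 0) (hlam' : X1.ParitySqueeze.AnalyticLambdaEq W' p n')
    (hS₀ : ∀ v ∈ S₀, ((p : ℕ) : 𝓞 ℚ) ∉ v.asIdeal)
    (hS : ∀ v : HeightOneSpectrum (𝓞 ℚ), v ∉ S₀ → ((p : ℕ) : 𝓞 ℚ) ∉ v.asIdeal →
      W.HasGoodReductionAt v)
    (hS' : ∀ v : HeightOneSpectrum (𝓞 ℚ), v ∉ S₀ → ((p : ℕ) : 𝓞 ℚ) ∉ v.asIdeal →
      W'.HasGoodReductionAt v)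
    (hiso : TorsionIso W W' p) {k : ℕ}
    (hk : (k : ℤ) = n' + ∑ v ∈ S₀, ((delta W' p v : ℤ) - (delta W p v : ℤ))) (hn : n ≤ k) :
    X2.MazurMainConjectureAt W p :=
  mazurMainConjectureAt_of_coveredRelativeAtThree_of_not_split S₀ (RowC6.thmA_atThree_OPEN_of_thmA hA) hWu
    hW16 hpar hT hT' hAm hBm hF hGV hA7 hB hp3 hmult hns hred hμ0 hlam hgood' hna' hμ0' hlam' hS₀ hS hS' hiso
    hk hn

end NonSplit

end Summit.BirchSwinnertonDyer.Rank1Residual.X2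

end
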